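import Mathlib
import HarnessLib
import Literature.Analysis.FluidPDE.Tao2016AveragedNS.LocalCascadeSolutions
import Literature.Analysis.FluidPDE.Tao2016AveragedNS.RenormalisedCascadeWaves
import Literature.Analysis.FluidPDE.Tao2016AveragedNS.SelfSimilarCascadeBlowup
import Literature.Analysis.FluidPDE.Tao2016AveragedNS.SelfSimilarCascadeResidues
import Literature.Analysis.FluidPDE.Tao2016AveragedNS.BoundedEternalSolutions
import Summits.NavierStokesRegularity.NavierStokesRegularity.Theses.TaoLadderRungTwoBreak

/-!
# The ACTION FLOOR of a surviving admissible DSS blow-up wave — a bounded-action slice of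
# K1(1) `TaoLadderRungTwoBreak.NoSurvivingDSSOne` (stmt-NavierStokesRegularity-20205)

MODEL lattice ODEs only (Tao 2016 §4, self-similar variables of §6.4; cell vocabulary `IsSWave`, `IsDSSWave`,
`dssMu`, `dssAction`, `Surviving`); nothing here is a statement about the Navier–Stokes equations; no summit,
crux or rung LEAF is proved (`--supports stmt-NavierStokesRegularity-20205`).

The tree's THEOREM B′ (`IsSWave.weighted_sEnergy_le`: `ẽ = e^{2dx}Σ_r‖Φ_r‖² ≤ e^{H}·Rsq`, `Rsq` the residue
at `+∞`, `H` the action exponent) bounds the residue FROM BELOW by the peak.  Here the complementary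
**wake–throughput identity** is proved — the weighted energy identity `ẽ' = 2(γ₁F̃(·+T) − γ₂F̃)` integrated over
the WHOLE line (`ẽ(−∞) = 0` for bounded profiles and `d > 0`): `Rsq = 2(γ₁ − γ₂)∫F̃` with
`|∫F̃| ≤ C_A · sup ẽ · M`, `M = ∫Σ_r‖Φ_r‖` — so the residue is bounded FROM ABOVE by the gain asymmetry times
the action, and with B′ the peak cancels: `Φ ≢ 0 ⟹ 1 ≤ 2·C_A·M·|γ₁ − γ₂|·e^{H}`
(`sWave_one_le_asymmetry_mul_action`).  For an admissible DSS wave of a cancelling table (`γ₁ = (μΛ)⁻¹`,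
`γ₂ = Λ⁻¹`, `μ = dssMu ε₀ T`, `H = dssAction ε₀ α T Φ`): **`1 + μ ≤ H·e^{H}·|1 − μ|`**
(`dssWave_one_add_dssMu_le`) — a near-perfect conveyor needs UNBOUNDED ACTION; under `Surviving a ε₀ T`
(`1 − μ ≤ aε₀`): **`1 ≤ aε₀·He^{H}`** (`dssWave_one_le_mul_action_of_surviving`; at `a = 1`:
`2 + ε₀ ≤ ε₀·He^{H}`), hence `H ≥ log(1/(aε₀)) − log log(1/(aε₀))` for `aε₀ ≤ e⁻¹`
(`dssWave_action_ge_log_of_surviving`) — uniformly over ALL cancelling tables, periods, shapes and delays.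
Consequently the **bounded-action slice of K1(1) is a THEOREM** (`noSurvivingDSS_rung_boundedAction`, explicit
threshold `εs = 1/(h₀e^{h₀}+1)` for action budget `h₀`), a case of the crux BY NAME
(`boundedAction_of_noSurvivingDSSOne`); what K1(1) adds is the regime `dssAction ≳ log(1/ε₀) → ∞`.  Compare the
tree's zero-residue slice `noSurvivingDSS_rung_zeroResidue` and the amplitude quantum `…SmallAmplitudeRung`.
-/

noncomputable section

-- the summit and its single sub-problem share the name (CONVENTIONS §1)
set_option linter.dupNamespace false

namespace Summit.NavierStokesRegularity.NavierStokesRegularity.Theorems.NoSurvivingDSSOne.ActionFloor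

open Set Filter Topology MeasureTheory
open scoped RealInnerProductSpace
open Literature.Analysis.FluidPDE Literature.Analysis.FluidPDE.TaoCascade
open Summit.NavierStokesRegularity.NavierStokesRegularity.Theses.TaoLadderRungTwoBreak

/-! ## Part 1.  Scalar core: the wake–throughput identity on the whole line -/

/-- **Throughput bound.**  If `|f| ≤ C·e·g(· − T)` with `0 ≤ e ≤ P` everywhere, `g ≥ 0` integrable and `f`
continuous, then `f` is integrable on `ℝ` and `|∫f| ≤ C·P·∫g`.
[cite: Tao2016AveragedNS, §4 Lemma 4.1 (4.9)–(4.10) (energy identity of a cascade, scalar form); elementary real analysis] -/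
theorem abs_integral_wflux_le {e f g : ℝ → ℝ} {T C P : ℝ} (hC : 0 ≤ C) (hf_cont : Continuous f)
    (he_nn : ∀ x, 0 ≤ e x) (hg_nn : ∀ x, 0 ≤ g x) (hflux : ∀ σ, |f σ| ≤ C * e σ * g (σ - T))
    (hg_int : Integrable g) (hP : ∀ x, e x ≤ P) :
    Integrable f ∧ |∫ σ, f σ| ≤ C * P * ∫ σ, g σ := by
  have hPnn : 0 ≤ P := (he_nn 0).trans (hP 0)
  have hdom_int : Integrable fun σ => C * P * g (σ - T) := (hg_int.comp_sub_right T).const_mul _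
  have hbound : ∀ σ, ‖f σ‖ ≤ C * P * g (σ - T) := by
    intro σ
    rw [Real.norm_eq_abs]
    calc |f σ| ≤ C * e σ * g (σ - T) := hflux σ
      _ ≤ C * P * g (σ - T) :=
          mul_le_mul_of_nonneg_right (mul_le_mul_of_nonneg_left (hP σ) hC) (hg_nn _)
  have hf_int : Integrable f :=
    Integrable.mono' hdom_int hf_cont.aestronglyMeasurable (Eventually.of_forall hbound)
  refine ⟨hf_int, ?_⟩
  have h1 : ‖∫ σ, f σ‖ ≤ ∫ σ, C * P * g (σ - T) :=
    norm_integral_le_of_norm_le hdom_int (Eventually.of_forall hbound)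
  rw [Real.norm_eq_abs] at h1
  have h2 : ∫ σ, C * P * g (σ - T) = C * P * ∫ σ, g σ := by
    rw [MeasureTheory.integral_const_mul, MeasureTheory.integral_sub_right_eq_self (fun σ => g σ) T]
  linarith

/-- **Wake–throughput identity (scalar form).**  For the weighted wave identity
`e' = 2(c₁ f(·+T) − c₂ f)` with `f` integrable, `e → 0` at `−∞` and `e → L` at `+∞`:
`L = 2(c₁ − c₂)∫f` — the residue equals the gain asymmetry times the throughput.
[cite: Tao2016AveragedNS, §4 Lemma 4.1 (4.9)–(4.10) (energy identity of a cascade, scalar form), §6.4; elementary real analysis] -/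
theorem throughput_identity {e f : ℝ → ℝ} {T c₁ c₂ L : ℝ}
    (hderiv : ∀ s, HasDerivAt e (2 * (c₁ * f (s + T) - c₂ * f s)) s) (hf_int : Integrable f)
    (hbot : Tendsto e atBot (𝓝 0)) (htop : Tendsto e atTop (𝓝 L)) :
    L = 2 * (c₁ - c₂) * ∫ σ, f σ := by
  have hint' : Integrable fun s => 2 * (c₁ * f (s + T) - c₂ * f s) :=
    (((hf_int.comp_add_right T).const_mul c₁).sub (hf_int.const_mul c₂)).const_mul 2
  have hftc := MeasureTheory.integral_of_hasDerivAt_of_tendsto hderiv hint' hbot htop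
  have hcalc : ∫ s, 2 * (c₁ * f (s + T) - c₂ * f s) = 2 * (c₁ - c₂) * ∫ σ, f σ := by
    rw [MeasureTheory.integral_const_mul, MeasureTheory.integral_sub ((hf_int.comp_add_right T).const_mul c₁)
      (hf_int.const_mul c₂), MeasureTheory.integral_const_mul, MeasureTheory.integral_const_mul,
      MeasureTheory.integral_add_right_eq_self (fun σ => f σ) T]
    ring
  rw [hcalc] at hftc
  linarith

/-- **Residue ≤ asymmetry × throughput (scalar form).**  Under the weighted wave identity with flux bound
`|f| ≤ C e g(·−T)`, `0 ≤ e ≤ P`, `g ≥ 0` integrable, `e(−∞) = 0`, `e(+∞) = L`: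
`L ≤ 2|c₁ − c₂|·C·P·∫g`.
[cite: Tao2016AveragedNS, §4 Lemma 4.1 (4.9)–(4.10), §6.4; elementary real analysis] -/
theorem residue_le_asymmetry {e f g : ℝ → ℝ} {T C P c₁ c₂ L : ℝ} (hC : 0 ≤ C) (hf_cont : Continuous f)
    (he_nn : ∀ x, 0 ≤ e x) (hg_nn : ∀ x, 0 ≤ g x)
    (hderiv : ∀ s, HasDerivAt e (2 * (c₁ * f (s + T) - c₂ * f s)) s)
    (hflux : ∀ σ, |f σ| ≤ C * e σ * g (σ - T)) (hg_int : Integrable g) (hP : ∀ x, e x ≤ P)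
    (hbot : Tendsto e atBot (𝓝 0)) (htop : Tendsto e atTop (𝓝 L)) :
    L ≤ 2 * |c₁ - c₂| * (C * P * ∫ σ, g σ) := by
  obtain ⟨hf_int, habs⟩ := abs_integral_wflux_le hC hf_cont he_nn hg_nn hflux hg_int hP
  have hid := throughput_identity hderiv hf_int hbot htop
  calc L = 2 * (c₁ - c₂) * ∫ σ, f σ := hid
    _ ≤ |2 * (c₁ - c₂) * ∫ σ, f σ| := le_abs_self _
    _ = 2 * |c₁ - c₂| * |∫ σ, f σ| := by rw [abs_mul, abs_mul, abs_two]
    _ ≤ 2 * |c₁ - c₂| * (C * P * ∫ σ, g σ) :=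
        mul_le_mul_of_nonneg_left habs (by positivity)

/-! ## Part 2.  S-waves: `1 ≤ 2 C_A M |γ₁ − γ₂| e^{H}` for every non-trivial admissible wave -/

section SWaves

variable {V : Type*} [NormedAddCommGroup V] [InnerProductSpace ℝ V]
variable {ρ : Type*} [Fintype ρ]

omit [InnerProductSpace ℝ V] in
/-- Bounded profiles and positive damping: the weighted energy `e^{2dx}Σ_r‖Φ_r x‖²` tends to `0` at `−∞`.
[cite: Tao2016AveragedNS, §4 Lemma 4.1 (4.9)–(4.10), §6.4; elementary] -/
theorem tendsto_weighted_sEnergy_atBot {d : ℝ} (hd : 0 < d) {Φ : ρ → ℝ → V} {Cb : ℝ}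
    (hB : ∀ r x, ‖Φ r x‖ ≤ Cb) :
    Tendsto (fun x => Real.exp (2 * d * x) * sEnergy Φ x) atBot (𝓝 0) := by
  set S₀ : ℝ := (Fintype.card ρ : ℝ) * Cb ^ 2 with hS₀
  have hSE : ∀ x, sEnergy Φ x ≤ S₀ := by
    intro x
    calc sEnergy Φ x = ∑ r, ‖Φ r x‖ ^ 2 := rfl
      _ ≤ ∑ _r : ρ, Cb ^ 2 := Finset.sum_le_sum fun r _ => by
          have h0 : 0 ≤ ‖Φ r x‖ := norm_nonneg _
          exact pow_le_pow_left₀ h0 (hB r x) 2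
      _ = S₀ := by rw [Finset.sum_const, nsmul_eq_mul, Finset.card_univ]
  have hexp : Tendsto (fun x : ℝ => Real.exp (2 * d * x)) atBot (𝓝 0) :=
    Real.tendsto_exp_atBot.comp (tendsto_id.const_mul_atBot (by positivity : 0 < 2 * d))
  have hup : Tendsto (fun x => Real.exp (2 * d * x) * S₀) atBot (𝓝 0) := by
    simpa using hexp.mul_const S₀
  refine tendsto_of_tendsto_of_tendsto_of_le_of_le tendsto_const_nhds hup ?_ ?_
  · intro x; exact mul_nonneg (Real.exp_pos _).le (sEnergy_nonneg Φ x)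
  · intro x; exact mul_le_mul_of_nonneg_left (hSE x) (Real.exp_pos _).le

/-- **Residue ≤ asymmetry × action × peak, for S-waves.**  An S-wave (`T > 0`, damping `d > 0`) with
integrable summed mass `M = ∫Σ_r‖Φ_r‖`, bounded profiles and residue `Rsq = lim_{+∞} e^{2dx}Σ_r‖Φ_r‖²`
satisfies `Rsq ≤ 2|c₁e^{−2dT} − c₂| · C_A · (e^{H}Rsq) · M`, `H = 2C_A(|c₁|e^{−2dT}+|c₂|)M`.
[cite: Tao2016AveragedNS, §4 (4.2)–(4.3), Lemma 4.1 (4.8)–(4.10), §6.4; cell theorems B/B′ + this file] -/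
theorem sWave_residue_le_asymmetry_mul_action {π : Equiv.Perm ρ} {Q A : V → V} {B : V → V → V}
    {CA d c₁ c₂ T : ℝ} (hS : STable Q A B CA) (hT : 0 < T) (hd : 0 < d) {Φ : ρ → ℝ → V}
    (hΦ : IsSWave π Q A B d c₁ c₂ T Φ) (hG : Integrable (sMass Φ)) {Cb : ℝ} (hB : ∀ r x, ‖Φ r x‖ ≤ Cb)
    {Rsq : ℝ} (hR : Tendsto (fun x => Real.exp (2 * d * x) * sEnergy Φ x) atTop (𝓝 Rsq)) :
    Rsq ≤ 2 * |c₁ * Real.exp (-(2 * d * T)) - c₂|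
      * (CA * (Real.exp (2 * CA * (|c₁| * Real.exp (-(2 * d * T)) + |c₂|) * ∫ σ, sMass Φ σ) * Rsq)
        * ∫ σ, sMass Φ σ) := by
  have hP := hΦ.weighted_sEnergy_le hS hT hG hR
  exact residue_le_asymmetry (e := fun x => Real.exp (2 * d * x) * sEnergy Φ x)
    (f := fun x => Real.exp (2 * d * x) * sFlux π A T Φ x) (g := sMass Φ)
    (c₁ := c₁ * Real.exp (-(2 * d * T))) (c₂ := c₂) hS.CA_nonneg
    (by have := hΦ.continuous_sFlux hS; fun_prop)
    (fun x => mul_nonneg (Real.exp_pos _).le (sEnergy_nonneg Φ x)) (sMass_nonneg Φ)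
    (hΦ.hasDerivAt_weighted_sEnergy hS) (hΦ.abs_weighted_sFlux_le hS) hG hP
    (tendsto_weighted_sEnergy_atBot hd hB) hR

/-- **THE ACTION INEQUALITY for S-waves.**  A NON-TRIVIAL S-wave (`T > 0`, `d > 0`) with integrable mass,
bounded profiles and weighted energy bounded on a right half-line satisfies
`1 ≤ 2 · C_A · M · |c₁e^{−2dT} − c₂| · exp(2C_A(|c₁|e^{−2dT}+|c₂|)M)`, `M = ∫Σ_r‖Φ_r‖`: a wave whose feed
and drain gains nearly balance (`c₁e^{−2dT} ≈ c₂`, the near-perfect conveyor) needs LARGE ACTION.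
[cite: Tao2016AveragedNS, §4 (4.2)–(4.3), Lemma 4.1 (4.8)–(4.10), §6.4; cell theorems B/B′ + this file] -/
theorem sWave_one_le_asymmetry_mul_action {π : Equiv.Perm ρ} {Q A : V → V} {B : V → V → V}
    {CA d c₁ c₂ T : ℝ} (hS : STable Q A B CA) (hT : 0 < T) (hd : 0 < d) {Φ : ρ → ℝ → V}
    (hΦ : IsSWave π Q A B d c₁ c₂ T Φ) (hG : Integrable (sMass Φ)) {Cb : ℝ} (hB : ∀ r x, ‖Φ r x‖ ≤ Cb)
    {x₀ P : ℝ} (hbdd : ∀ x, x₀ ≤ x → Real.exp (2 * d * x) * sEnergy Φ x ≤ P)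
    (hne : ∃ r x, Φ r x ≠ 0) :
    1 ≤ 2 * CA * (∫ σ, sMass Φ σ) * |c₁ * Real.exp (-(2 * d * T)) - c₂|
      * Real.exp (2 * CA * (|c₁| * Real.exp (-(2 * d * T)) + |c₂|) * ∫ σ, sMass Φ σ) := by
  obtain ⟨Rsq, hR⟩ := hΦ.exists_residue_limit hS hT hG hbdd
  have hpos : 0 < Rsq := hΦ.residue_pos hS hT hG hR hne
  have h := sWave_residue_le_asymmetry_mul_action hS hT hd hΦ hG hB hR
  refine le_of_mul_le_mul_left ?_ hpos
  calc Rsq * 1 = Rsq := mul_one _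
    _ ≤ _ := h
    _ = _ := by ring

end SWaves

/-! ## Part 3.  Admissible DSS waves of a cancelling table: `1 + μ ≤ H e^{H} |1 − μ|` -/

section DSS

variable {ρ : Type*} [Fintype ρ] {m : ℕ}

/-- The action exponent of a DSS wave is non-negative. [cite: Tao2016AveragedNS, §4 (4.1), (4.8); cell vocabulary] -/
theorem dssAction_nonneg (ε₀ : ℝ) (α : Fin m → Fin m → Fin m → ℤ × ℤ × ℤ → ℝ) (T : ℝ)
    (Φ : ρ → ℝ → Em m) : 0 ≤ dssAction ε₀ α T Φ := by
  unfold dssAction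
  have h1 : 0 ≤ fluxConst α := fluxConst_nonneg α
  have h2 : 0 ≤ ∫ σ, sMass Φ σ := integral_nonneg (sMass_nonneg Φ)
  positivity

/-- **`1 + μ ≤ H·e^{H}·|1 − μ|` for every non-trivial admissible DSS wave of a cancelling table**
(`μ = dssMu ε₀ T` the per-shell energy ratio, `H = dssAction ε₀ α T Φ` the action exponent; any period,
shape permutation, delay, any `ε₀ > 0`).  The perfect conveyor `μ = 1` is excluded outright and a
near-perfect one needs unbounded action.
[cite: Tao2016AveragedNS, §4 (4.2)–(4.3), Lemma 4.1 (4.8)–(4.10), §6.4; cell theorems B/B′ + this file] -/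
theorem dssWave_one_add_dssMu_le {ε₀ : ℝ} {α : Fin m → Fin m → Fin m → ℤ × ℤ × ℤ → ℝ}
    {π : Equiv.Perm ρ} {T : ℝ} {Φ : ρ → ℝ → Em m} (hε : 0 < ε₀) (hc : IsCancellingCoeff α)
    (hW : IsDSSWave ε₀ α π T Φ) (hne : ∃ r x, Φ r x ≠ 0) :
    1 + dssMu ε₀ T ≤ dssAction ε₀ α T Φ * Real.exp (dssAction ε₀ α T Φ) * |1 - dssMu ε₀ T| := by
  obtain ⟨Cb, hB⟩ := hW.uniformBound
  obtain ⟨x₀, P, hP⟩ := hW.bdd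
  have hP' : ∀ x, x₀ ≤ x → Real.exp (2 * (1 : ℝ) * x) * sEnergy Φ x ≤ P := fun x hx => by
    have := hP x hx; unfold wEnergy at this; exact this
  have key := sWave_one_le_asymmetry_mul_action (table_sTable α hc) hW.delay_pos one_pos hW.wave hW.mass hB
    hP' hne
  -- abbreviations
  set L := bigLam ε₀ with hLdef
  set E := Real.exp (2 * T) with hEdef
  set M := ∫ σ, sMass Φ σ with hMdef
  set CA := fluxConst α with hCAdef
  have hL : 0 < L := bigLam_pos (by linarith)
  have hE : 0 < E := Real.exp_pos _
  have hL2 : L ^ 2 = (1 + ε₀) ^ 5 := bigLam_sq hε.le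
  have hμ : dssMu ε₀ T = E / L ^ 2 := by unfold dssMu; rw [hL2]
  have hexpneg : Real.exp (-(2 * (1 : ℝ) * T)) = E⁻¹ := by
    rw [show (2 : ℝ) * 1 * T = 2 * T by ring, Real.exp_neg]
  have habsL : |L| = L := abs_of_pos hL
  have habsLi : |L⁻¹| = L⁻¹ := abs_of_pos (inv_pos.2 hL)
  -- the action exponent in the abbreviations
  have hH : dssAction ε₀ α T Φ = 2 * CA * ((1 + E / L ^ 2) * (L / E)) * M := by
    unfold dssAction
    rw [← hCAdef, ← hLdef, ← hMdef, habsL, habsLi, hexpneg]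
    congr 1; congr 1
    field_simp
  -- the asymmetry in the abbreviations
  have hD : |L * Real.exp (-(2 * (1 : ℝ) * T)) - L⁻¹| = |1 - E / L ^ 2| * (L / E) := by
    rw [hexpneg, show L * E⁻¹ - L⁻¹ = (1 - E / L ^ 2) * (L / E) by field_simp, abs_mul,
      abs_of_pos (div_pos hL hE)]
  have hX : Real.exp (2 * CA * (|L| * Real.exp (-(2 * (1 : ℝ) * T)) + |L⁻¹|) * M)
      = Real.exp (dssAction ε₀ α T Φ) := by
    unfold dssAction; rw [← hCAdef, ← hLdef, ← hMdef]
  rw [hD, hX] at key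
  have hμpos : 0 < 1 + E / L ^ 2 := by positivity
  rw [hμ]
  calc 1 + E / L ^ 2 = (1 + E / L ^ 2) * 1 := (mul_one _).symm
    _ ≤ (1 + E / L ^ 2) * (2 * CA * M * (|1 - E / L ^ 2| * (L / E)) * Real.exp (dssAction ε₀ α T Φ)) :=
        mul_le_mul_of_nonneg_left key hμpos.le
    _ = (2 * CA * ((1 + E / L ^ 2) * (L / E)) * M) * Real.exp (dssAction ε₀ α T Φ) * |1 - E / L ^ 2| := by
        ring
    _ = dssAction ε₀ α T Φ * Real.exp (dssAction ε₀ α T Φ) * |1 - E / L ^ 2| := by rw [← hH]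

/-- **THE ACTION FLOOR of an `(S_a)`-surviving admissible DSS wave.**  For `ε₀ > 0`, `a ≥ 0`, a cancelling
table, and a NON-TRIVIAL admissible DSS wave with `Surviving a ε₀ T` (`(1+ε₀)^{−a} ≤ μ < 1`):
`1 ≤ aε₀ · H·e^{H}`, `H = dssAction ε₀ α T Φ`.
[cite: Tao2016AveragedNS, §4 (4.2)–(4.3), Lemma 4.1 (4.8)–(4.10), §6.4; cell theorems B/B′ + this file] -/
theorem dssWave_one_le_mul_action_of_surviving {ε₀ a : ℝ} {α : Fin m → Fin m → Fin m → ℤ × ℤ × ℤ → ℝ}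
    {π : Equiv.Perm ρ} {T : ℝ} {Φ : ρ → ℝ → Em m} (hε : 0 < ε₀) (ha : 0 ≤ a) (hc : IsCancellingCoeff α)
    (hW : IsDSSWave ε₀ α π T Φ) (hS : Surviving a ε₀ T) (hne : ∃ r x, Φ r x ≠ 0) :
    1 ≤ a * ε₀ * (dssAction ε₀ α T Φ * Real.exp (dssAction ε₀ α T Φ)) := by
  have h := dssWave_one_add_dssMu_le hε hc hW hne
  have hμ1 : dssMu ε₀ T < 1 := hS.2
  have hμ0 : 0 < dssMu ε₀ T := dssMu_pos T (by linarith)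
  have hgap : 1 - dssMu ε₀ T ≤ a * ε₀ := one_sub_dssMu_le_of_surviving hε ha hS
  have habs : |1 - dssMu ε₀ T| = 1 - dssMu ε₀ T := abs_of_pos (by linarith)
  rw [habs] at h
  have hHX : 0 ≤ dssAction ε₀ α T Φ * Real.exp (dssAction ε₀ α T Φ) :=
    mul_nonneg (dssAction_nonneg ε₀ α T Φ) (Real.exp_pos _).le
  calc (1 : ℝ) ≤ 1 + dssMu ε₀ T := by linarith
    _ ≤ dssAction ε₀ α T Φ * Real.exp (dssAction ε₀ α T Φ) * (1 - dssMu ε₀ T) := h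
    _ ≤ dssAction ε₀ α T Φ * Real.exp (dssAction ε₀ α T Φ) * (a * ε₀) :=
        mul_le_mul_of_nonneg_left hgap hHX
    _ = a * ε₀ * (dssAction ε₀ α T Φ * Real.exp (dssAction ε₀ α T Φ)) := by ring

/-- The sharp `a = 1` form: **`2 + ε₀ ≤ ε₀ · H·e^{H}`** for every non-trivial `(S₁)`-surviving admissible DSS
wave of a cancelling table (`1 + μ ≥ 1 + (1+ε₀)⁻¹`, `1 − μ ≤ ε₀/(1+ε₀)`).
[cite: Tao2016AveragedNS, §4 (4.2)–(4.3), Lemma 4.1 (4.8)–(4.10), §6.4; cell theorems B/B′ + this file] -/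
theorem dssWave_two_add_le_mul_action_of_surviving_one {ε₀ : ℝ}
    {α : Fin m → Fin m → Fin m → ℤ × ℤ × ℤ → ℝ} {π : Equiv.Perm ρ} {T : ℝ} {Φ : ρ → ℝ → Em m}
    (hε : 0 < ε₀) (hc : IsCancellingCoeff α) (hW : IsDSSWave ε₀ α π T Φ) (hS : Surviving 1 ε₀ T)
    (hne : ∃ r x, Φ r x ≠ 0) :
    2 + ε₀ ≤ ε₀ * (dssAction ε₀ α T Φ * Real.exp (dssAction ε₀ α T Φ)) := by
  have h := dssWave_one_add_dssMu_le hε hc hW hne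
  set μ := dssMu ε₀ T with hμdef
  set Y := dssAction ε₀ α T Φ * Real.exp (dssAction ε₀ α T Φ) with hYdef
  have hμ1 : μ < 1 := hS.2
  have hlow : (1 + ε₀)⁻¹ ≤ μ := by
    have := hS.1; rwa [Real.rpow_neg_one] at this
  have habs : |1 - μ| = 1 - μ := abs_of_pos (by linarith)
  rw [habs] at h
  have hY : 0 ≤ Y := mul_nonneg (dssAction_nonneg ε₀ α T Φ) (Real.exp_pos _).le
  have hb : 0 < 1 + ε₀ := by linarith
  have h1 : (2 + ε₀) / (1 + ε₀) ≤ 1 + μ := by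
    have : (2 + ε₀) / (1 + ε₀) = 1 + (1 + ε₀)⁻¹ := by field_simp; ring
    rw [this]; linarith
  have h2 : 1 - μ ≤ ε₀ / (1 + ε₀) := by
    have : ε₀ / (1 + ε₀) = 1 - (1 + ε₀)⁻¹ := by field_simp; ring
    rw [this]; linarith
  have h3 : (2 + ε₀) / (1 + ε₀) ≤ Y * (ε₀ / (1 + ε₀)) :=
    h1.trans (h.trans (mul_le_mul_of_nonneg_left h2 hY))
  have h4 := mul_le_mul_of_nonneg_right h3 hb.le
  rw [div_mul_cancel₀ _ hb.ne'] at h4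
  calc 2 + ε₀ ≤ Y * (ε₀ / (1 + ε₀)) * (1 + ε₀) := h4
    _ = ε₀ * Y := by field_simp

/-- Lambert-type inversion: `y ≥ e` and `y ≤ x·eˣ` with `x ≥ 0` force `x ≥ log y − log log y`. [elementary] -/
theorem log_sub_loglog_le_of_le_mul_exp {x y : ℝ} (hx : 0 ≤ x) (hy : Real.exp 1 ≤ y)
    (h : y ≤ x * Real.exp x) : Real.log y - Real.log (Real.log y) ≤ x := by
  have hypos : 0 < y := (Real.exp_pos 1).trans_le hy
  have hlogy : 1 ≤ Real.log y := by
    rw [← Real.log_exp 1]; exact Real.log_le_log (Real.exp_pos 1) hy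
  have hlogypos : 0 < Real.log y := by linarith
  have hloglog : 0 ≤ Real.log (Real.log y) := Real.log_nonneg hlogy
  set x₀ := Real.log y - Real.log (Real.log y) with hx₀def
  have hx₀le : x₀ ≤ Real.log y := by linarith
  by_contra hlt
  push Not at hlt
  -- `x₀ > x ≥ 0`, so `x eˣ < x₀ e^{x₀} = x₀ · y / log y ≤ y`
  have hx₀pos : 0 < x₀ := hx.trans_lt hlt
  have hexp₀ : Real.exp x₀ = y / Real.log y := by
    rw [hx₀def, Real.exp_sub, Real.exp_log hypos, Real.exp_log hlogypos]
  have hlt' : x * Real.exp x < x₀ * Real.exp x₀ :=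
    mul_lt_mul hlt (Real.exp_le_exp.2 hlt.le) (Real.exp_pos _) hx₀pos.le
  have hle' : x₀ * Real.exp x₀ ≤ y := by
    rw [hexp₀]
    calc x₀ * (y / Real.log y) = (x₀ / Real.log y) * y := by ring
      _ ≤ 1 * y := by
          refine mul_le_mul_of_nonneg_right ?_ hypos.le
          rwa [div_le_one hlogypos]
      _ = y := one_mul _
  linarith

/-- **Logarithmic action floor.**  A non-trivial `(S_a)`-surviving admissible DSS wave of a cancelling table
with `0 < aε₀ ≤ e⁻¹` has action exponent `H ≥ log(1/(aε₀)) − log log(1/(aε₀))`: a counterexample family to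
K1(1) (`a = 1`, `ε₀ → 0` on a fixed class) has `dssAction ≥ log(1/ε₀) − log log(1/ε₀) → ∞`.
[cite: Tao2016AveragedNS, §4 (4.2)–(4.3), Lemma 4.1 (4.8)–(4.10), §6.4; cell theorems B/B′ + this file] -/
theorem dssWave_action_ge_log_of_surviving {ε₀ a : ℝ} {α : Fin m → Fin m → Fin m → ℤ × ℤ × ℤ → ℝ}
    {π : Equiv.Perm ρ} {T : ℝ} {Φ : ρ → ℝ → Em m} (hε : 0 < ε₀) (ha : 0 < a) (hc : IsCancellingCoeff α)
    (hW : IsDSSWave ε₀ α π T Φ) (hS : Surviving a ε₀ T) (hne : ∃ r x, Φ r x ≠ 0)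
    (hsmall : a * ε₀ ≤ (Real.exp 1)⁻¹) :
    Real.log (1 / (a * ε₀)) - Real.log (Real.log (1 / (a * ε₀))) ≤ dssAction ε₀ α T Φ := by
  have h := dssWave_one_le_mul_action_of_surviving hε ha.le hc hW hS hne
  have haε : 0 < a * ε₀ := mul_pos ha hε
  have hy : 1 / (a * ε₀) ≤ dssAction ε₀ α T Φ * Real.exp (dssAction ε₀ α T Φ) := by
    rw [div_le_iff₀ haε]; linarith [h]
  have hye : Real.exp 1 ≤ 1 / (a * ε₀) := by
    rw [le_div_iff₀ haε]
    calc Real.exp 1 * (a * ε₀) ≤ Real.exp 1 * (Real.exp 1)⁻¹ :=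
          mul_le_mul_of_nonneg_left hsmall (Real.exp_pos 1).le
      _ = 1 := mul_inv_cancel₀ (Real.exp_pos 1).ne'
  exact log_sub_loglog_le_of_le_mul_exp (dssAction_nonneg ε₀ α T Φ) hye hy

end DSS

/-! ## Part 4.  The bounded-action slice of K1(1) is a theorem, and a case of the crux by name -/

/-- **K1(1) HOLDS ON EVERY BOUNDED-ACTION CLASS.**  For every action budget `h₀ ≥ 0` and every spread `R`:
with the explicit threshold `εs = 1/(h₀e^{h₀} + 1)`, for all `ε₀ ∈ (0, εs]` no table of `InTableClass R`
carries a non-trivial `(S₁)`-surviving admissible DSS wave (any period `q`, shape permutation, delay) of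
action exponent `dssAction ≤ h₀`.  (The quantifier shape of `TaoCascade.NoSurvivingDSS R 1` with one extra
hypothesis; only cancellation (4.3) of the class is used.)
[cite: Tao2016AveragedNS, §4 Thm. 4.2 (statement shape), (4.2)–(4.3), Lemma 4.1 (4.8)–(4.10), §6.4; cell theorems B/B′ + this file] -/
theorem noSurvivingDSS_rung_boundedAction (h₀ : ℝ) (hh₀ : 0 ≤ h₀) (R : ℝ) :
    ∃ εs : ℝ, 0 < εs ∧ ∀ ε₀ : ℝ, 0 < ε₀ → ε₀ ≤ εs →
      ∀ α : Fin 4 → Fin 4 → Fin 4 → ℤ × ℤ × ℤ → ℝ, InTableClass R α →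
        ∀ (q : ℕ) (π : Equiv.Perm (Fin q)) (T : ℝ) (Φ : Fin q → ℝ → Em 4),
          IsDSSWave ε₀ α π T Φ → Surviving 1 ε₀ T → dssAction ε₀ α T Φ ≤ h₀ → ∀ r x, Φ r x = 0 := by
  have hden : 0 < h₀ * Real.exp h₀ + 1 := by positivity
  refine ⟨1 / (h₀ * Real.exp h₀ + 1), by positivity, ?_⟩
  intro ε₀ hε₀ hle α hα q π T Φ hW hS hH r x
  by_contra hrx
  have hne : ∃ r x, Φ r x ≠ 0 := ⟨r, x, hrx⟩
  have h1 := dssWave_one_le_mul_action_of_surviving hε₀ zero_le_one hα.2.1 hW hS hne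
  have h2 : dssAction ε₀ α T Φ * Real.exp (dssAction ε₀ α T Φ) ≤ h₀ * Real.exp h₀ :=
    mul_le_mul hH (Real.exp_le_exp.2 hH) (Real.exp_pos _).le ((dssAction_nonneg ε₀ α T Φ).trans hH)
  have h3 : (1 : ℝ) ≤ ε₀ * (h₀ * Real.exp h₀) := by
    calc (1 : ℝ) ≤ 1 * ε₀ * (dssAction ε₀ α T Φ * Real.exp (dssAction ε₀ α T Φ)) := h1
      _ = ε₀ * (dssAction ε₀ α T Φ * Real.exp (dssAction ε₀ α T Φ)) := by ring
      _ ≤ ε₀ * (h₀ * Real.exp h₀) := mul_le_mul_of_nonneg_left h2 hε₀.le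
  have h4 : ε₀ * (h₀ * Real.exp h₀) ≤ 1 / (h₀ * Real.exp h₀ + 1) * (h₀ * Real.exp h₀) :=
    mul_le_mul_of_nonneg_right hle (by positivity)
  have h5 : 1 / (h₀ * Real.exp h₀ + 1) * (h₀ * Real.exp h₀) < 1 := by
    rw [div_mul_eq_mul_div, one_mul, div_lt_one hden]; linarith
  linarith

/-- The slice IS a case of the crux: `NoSurvivingDSSOne` gives the bounded-action statement (with the
crux's threshold, for every budget). [cite: Tao2016AveragedNS, §4 Thm. 4.2 (statement shape); cell vocabulary] -/
theorem boundedAction_of_noSurvivingDSSOne (hK : NoSurvivingDSSOne) (h₀ R : ℝ) (hR : 1 ≤ R) :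
    ∃ εs : ℝ, 0 < εs ∧ ∀ ε₀ : ℝ, 0 < ε₀ → ε₀ ≤ εs →
      ∀ α : Fin 4 → Fin 4 → Fin 4 → ℤ × ℤ × ℤ → ℝ, InTableClass R α →
        ∀ (q : ℕ) (π : Equiv.Perm (Fin q)) (T : ℝ) (Φ : Fin q → ℝ → Em 4),
          IsDSSWave ε₀ α π T Φ → Surviving 1 ε₀ T → dssAction ε₀ α T Φ ≤ h₀ → ∀ r x, Φ r x = 0 := by
  obtain ⟨εs, hεs, H⟩ := hK R hR
  exact ⟨εs, hεs, fun ε₀ hε₀ hle α hα q π T Φ hW hS _ => H ε₀ hε₀ hle α hα q π T Φ hW hS⟩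

end Summit.NavierStokesRegularity.NavierStokesRegularity.Theorems.NoSurvivingDSSOne.ActionFloor

end
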